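import Summits.NavierStokesRegularity.NavierStokesRegularity.Theses.HardyPointSink
import Summits.NavierStokesRegularity.NavierStokesRegularity.Theorems.HardyPointSinkHardyEnergyBoundRegularTopGradient
import Summits.NavierStokesRegularity.NavierStokesRegularity.Theorems.HardyPointSinkHardyEnergyBoundDivergentInflux
import Summits.NavierStokesRegularity.NavierStokesRegularity.Theorems.HardyPointSinkHardyEnergyBoundConverseCutoff
import HarnessLib

/-!
# Route HardyPointSink — crux `HardyEnergyBound` (item stmt-NavierStokesRegularity-7979):
# the representative near a REGULAR point of the final time

Support file (theorems only, `--supports stmt-NavierStokesRegularity-7979`; lead c7 of the crux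
line, 2026-08-17).  Lead c6 proved (`…DivergentInflux`) that at every backward singular point
`(T, x_*)` of a Kato solution the Hardy dissipation of the classical representative at `x_*` (and,
for Clay data, the cumulative head influx toward `x_*`) DIVERGES as `t ↑ T`.  This file supplies
the converse half at the REGULAR points of the final time:

* `bounds_near_top_of_not_isBackwardSingularPoint` — Kato solution `u` on `[0, T)`, classical
  representative `(v, p)` on `(0, T)`, `(T, x_*)` NOT a backward singular point of `u`: `v` and
  `∇v` are bounded on a backward parabolic neighbourhood `(T − r², T) × B(x_*, r)` (the smooth
  Kato representative `u' = v` on `(0, T)` is essentially bounded near `(T, x_*)`, its strip frame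
  is `katoLocalEnergyNearTop`, and `fderiv_bounded_near_top_of_isBoundedNearTop_strip` of
  `…RegularTopGradient` applies).
* `isBackwardSingularPoint_iff_hardyDissipation_eq_top` — with c6's theorem: **`(T, x_*)` is a
  backward singular point of `u` iff the Hardy dissipation of the representative at `x_*` is
  infinite on every box** (no Clay hypothesis on the datum is needed).
* two sink-wise estimates used by `…RegularInflux` (the influx half): with the plateau cut-off
  `φ` of the ledger centred at the sink `x₀` (scale `R/4`), a field bounded by `A` on `B(x₀, R/4)`
  has `ofReal ∫ φ|w|²/|x − x₀| ≤ A²(5/2)|B₁|(R/4)²` (`hardyEnergyBound_regular_ofReal_hardy_le`), and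
  a gradient bounded by `G` there over a time window gives
  `ofReal(2ν∫∫φ|∇v|²_F/|x − x₀| + 4πν∫|v(s,x₀)|²) ≤ (2ν·3G²(5/2)|B₁|(R/4)² + 4πνA²)·|window|`
  (`hardyEnergyBound_regular_ofReal_dissipation_le`).

References: G. Seregin, V. Šverák, Comm. PDE 34 (2009), §2 p. 8 [SereginSverak2009]; G. Seregin,
*Lecture Notes on Regularity Theory for the Navier–Stokes Equations* (2014), Ch. 6, Thm. 1.4
[Seregin2014]; L. Caffarelli, R. Kohn, L. Nirenberg, Comm. Pure Appl. Math. 35 (1982), §2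
[CKN1982].
-/


-- the problem directory repeats the summit name (D-0017); core's `dupNamespace` linter fires
set_option linter.dupNamespace false

noncomputable section

open Set MeasureTheory Filter Topology TopologicalSpace Function Metric Module
open scoped ENNReal NNReal InnerProductSpace Laplacian
open Literature.Analysis.FluidPDE Literature.Analysis.FunctionSpaces Literature.Analysis.PDE

namespace Summit.NavierStokesRegularity.NavierStokesRegularity.Theorems

open AxisymmetricKatoGlobal.Registered

/-! ### Bounds on the representative near a regular point of the final time -/

/-- **At a regular point of the final time the representative and its gradient are bounded.**
For `ν > 0`, `T > 0`, a Kato solution `u` on `[0, T)` from `u₀`, a classical solution `(v, p)` on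
`(0, T)` representing it (`v t = u t` a.e. for `0 < t < T`) and a point `x_*` such that `(T, x_*)`
is NOT a backward singular point of `u` (`u ∈ L^∞(Q_r(T, x_*))` for some `r > 0`): there are
`r > 0` and `A, G` with `‖v(t,x)‖ ≤ A`, `‖∇v(t)(x)‖ ≤ G` for `T − r² < t < T`, `x ∈ B(x_*, r)`.
Proof: the field `u'` equal to `v` on `(0,T)` and to `u` elsewhere is a smooth Kato solution from
`u₀`, essentially bounded on a small cylinder at `(T, x_*)` (it agrees with `u` a.e. on the strip),
hence bounded near `(T, x_*)` (`isBoundedNearTop_of_eLpNorm_cylinder_lt_top`); its strip frame is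
`katoLocalEnergyNearTop`, and `fderiv_bounded_near_top_of_isBoundedNearTop_strip` bounds `∇u' = ∇v`.
[cite: SereginSverak2009, §2 p. 8] -/
theorem bounds_near_top_of_not_isBackwardSingularPoint {ν : ℝ} (hν : 0 < ν)
    {u₀ : EuclideanSpace ℝ (Fin 3) → EuclideanSpace ℝ (Fin 3)} {T : ℝ} (hT : 0 < T)
    {u : ℝ → EuclideanSpace ℝ (Fin 3) → EuclideanSpace ℝ (Fin 3)} (hu : IsKatoSolutionOn T ν u₀ u)
    {v : ℝ → EuclideanSpace ℝ (Fin 3) → EuclideanSpace ℝ (Fin 3)}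
    {p : ℝ → EuclideanSpace ℝ (Fin 3) → ℝ} (hcl : IsClassicalNSSolutionOn (Ioo 0 T) ν 0 v p)
    (hae : ∀ t ∈ Ioo 0 T, v t =ᵐ[volume] u t)
    {xs : EuclideanSpace ℝ (Fin 3)}
    (hreg : ¬ IsBackwardSingularPoint u ((T, xs) : ℝ × EuclideanSpace ℝ (Fin 3))) :
    ∃ r > 0, ∃ A G : ℝ, ∀ t ∈ Ioo (T - r ^ 2) T, ∀ x ∈ ball xs r,
      ‖v t x‖ ≤ A ∧ ‖fderiv ℝ (v t) x‖ ≤ G := by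
  -- ### the smooth Kato representative `u'` (pattern of `hardyDissipation_eq_top_of_isBackwardSingularPoint`)
  set u' : ℝ → EuclideanSpace ℝ (Fin 3) → EuclideanSpace ℝ (Fin 3) :=
    fun t => if t ∈ Ioo 0 T then v t else u t with hu'_def
  have hu'_in : ∀ t ∈ Ioo 0 T, u' t = v t := fun t ht => by
    simp only [hu'_def]
    exact if_pos ht
  have hu'_ae : ∀ t ∈ Ico 0 T, u' t =ᵐ[volume] u t := by
    intro t ht
    by_cases hto : t ∈ Ioo 0 T
    · rw [hu'_in t hto]
      exact hae t hto
    · have : u' t = u t := by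
        simp only [hu'_def]
        exact if_neg hto
      rw [this]
  have hstrip : IsOpen (Ioo (0 : ℝ) T ×ˢ (univ : Set (EuclideanSpace ℝ (Fin 3)))) :=
    isOpen_Ioo.prod isOpen_univ
  have hu'_eqOn : EqOn (uncurry u') (uncurry v) (Ioo 0 T ×ˢ univ) := by
    rintro ⟨t, x⟩ ⟨ht, -⟩
    simp [hu'_in t ht]
  have hw : IsSmoothSpaceTimeOn (Ioo 0 T) v := hcl.smooth_velocity
  have hu'_meas : AEStronglyMeasurable (uncurry u') (volume.restrict (Ioo 0 T ×ˢ univ)) := by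
    refine (hw.continuousOn.aestronglyMeasurable hstrip.measurableSet).congr ?_
    filter_upwards [ae_restrict_mem hstrip.measurableSet] with z hz
    exact (hu'_eqOn hz).symm
  have hu' : IsKatoSolutionOn T ν u₀ u' := by
    refine ⟨hu.mild.congr_ae_Ico hu'_ae EventuallyEq.rfl,
      hu.continuousInLpOn.congr_ae_slices hu'_ae, ?_, hu'_meas⟩
    have h0 : (0 : ℝ) ∉ Ioo 0 T := fun h => lt_irrefl _ h.1
    have : u' 0 = u 0 := by
      simp only [hu'_def]
      exact if_neg h0
    rw [this, hu.initial]
  have hsm' : ContDiffOn ℝ (⊤ : ℕ∞) (uncurry u') (Ioo 0 T ×ˢ univ) := hw.congr hu'_eqOn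
  have hae' : uncurry u' =ᵐ[volume.restrict (Ioo 0 T ×ˢ univ)] uncurry u :=
    ae_restrict_prod_of_forall_ae_eq (fun t ht => hu'_ae t ⟨ht.1.le, ht.2⟩) hu'_meas
      hu.aestronglyMeasurable
  -- ### `u'` is essentially bounded on a small cylinder at `(T, xs)`, hence bounded near `(T, xs)`
  obtain ⟨r, hr, hfin⟩ : ∃ r : ℝ, 0 < r ∧ eLpNorm (uncurry u) ∞
      (volume.restrict (parabolicCylinder r ((T, xs) : ℝ × EuclideanSpace ℝ (Fin 3)))) < ∞ := by
    by_contra h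
    exact hreg fun r' hr' => by
      by_contra hne
      exact h ⟨r', hr', lt_top_iff_ne_top.2 hne⟩
  set ρ : ℝ := min r (Real.sqrt T) with hρ_def
  have hρ : 0 < ρ := lt_min hr (Real.sqrt_pos.2 hT)
  have hρr : ρ ≤ r := min_le_left _ _
  have hρT : ρ ^ 2 ≤ T := by
    calc ρ ^ 2 ≤ Real.sqrt T ^ 2 := pow_le_pow_left₀ hρ.le (min_le_right _ _) 2
      _ = T := Real.sq_sqrt hT.le
  have hsub : parabolicCylinder ρ ((T, xs) : ℝ × EuclideanSpace ℝ (Fin 3)) ⊆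
      Ioo 0 T ×ˢ (univ : Set (EuclideanSpace ℝ (Fin 3))) :=
    parabolicCylinder_subset_strip hρT le_rfl xs
  have hmonoQ : parabolicCylinder ρ ((T, xs) : ℝ × EuclideanSpace ℝ (Fin 3)) ⊆
      parabolicCylinder r ((T, xs) : ℝ × EuclideanSpace ℝ (Fin 3)) := by
    have h2 : ρ ^ 2 ≤ r ^ 2 := pow_le_pow_left₀ hρ.le hρr 2
    exact prod_mono (Ioo_subset_Ioo (by simp only; linarith) le_rfl) (ball_subset_ball hρr)
  have hfin' : eLpNorm (uncurry u') ∞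
      (volume.restrict (Ioo (T - ρ ^ 2) T ×ˢ ball xs ρ)) < ∞ := by
    have e : Ioo (T - ρ ^ 2) T ×ˢ ball xs ρ =
        parabolicCylinder ρ ((T, xs) : ℝ × EuclideanSpace ℝ (Fin 3)) := rfl
    rw [e, eLpNorm_congr_ae (ae_restrict_of_ae_restrict_of_subset hsub hae')]
    exact lt_of_le_of_lt (eLpNorm_mono_measure _ (Measure.restrict_mono hmonoQ le_rfl)) hfin
  have hbd' : IsBoundedNearTop u' T xs :=
    isBoundedNearTop_of_eLpNorm_cylinder_lt_top hsm'.continuousOn (pow_pos hρ 2) hρT hρ hfin'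
  -- ### the strip frame of `u'` and the gradient bound
  obtain ⟨hsw, hloc⟩ := katoLocalEnergyNearTop hν hT hu' hsm'
  obtain ⟨r₀, hr₀, K₀, hK₀⟩ := hbd'
  obtain ⟨r₁, hr₁, G, hG⟩ := fderiv_bounded_near_top_of_isBoundedNearTop_strip hν hT hsm' hsw hloc
    ⟨r₀, hr₀, K₀, hK₀⟩
  -- ### back to `v` on `(T - r'², T) ⊆ (0, T)`
  set r' : ℝ := min (min r₀ r₁) (Real.sqrt T) with hr'_def
  have hr'pos : 0 < r' := lt_min (lt_min hr₀ hr₁) (Real.sqrt_pos.2 hT)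
  have hr'₀ : r' ≤ r₀ := (min_le_left _ _).trans (min_le_left _ _)
  have hr'₁ : r' ≤ r₁ := (min_le_left _ _).trans (min_le_right _ _)
  have hr'T : r' ^ 2 ≤ T := by
    calc r' ^ 2 ≤ Real.sqrt T ^ 2 := pow_le_pow_left₀ hr'pos.le (min_le_right _ _) 2
      _ = T := Real.sq_sqrt hT.le
  refine ⟨r', hr'pos, K₀, G, fun t ht x hx => ?_⟩
  have htI : t ∈ Ioo 0 T := ⟨by linarith [ht.1], ht.2⟩
  have hvt : v t = u' t := (hu'_in t htI).symm
  rw [hvt]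
  exact ⟨IsBoundedNearTop.of_le hr'pos hr'₀ hK₀ t ht x hx,
    hG t ⟨by nlinarith [ht.1, pow_le_pow_left₀ hr'pos.le hr'₁ 2], ht.2⟩ x (ball_subset_ball hr'₁ hx)⟩

/-! ### The Hardy dissipation of the representative classifies the backward singular points -/

/-- **`(T, x_*)` is a backward singular point iff the Hardy dissipation of the representative at
`x_*` is infinite on every box.**  For `ν > 0`, `T > 0`, a Kato solution `u` on `[0, T)`, a
classical representative `(v, p)` on `(0, T)` and any `x_*`:
`IsBackwardSingularPoint u (T, x_*) ↔ ∀ δ ρ₀ > 0, ∫∫_{(T−δ,T)×B(x_*,ρ₀)} |∇v|²_F/|x − x_*| = ∞`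
(`→`: lead c6's `hardyDissipation_eq_top_of_isBackwardSingularPoint`; `←`: at a regular point
`∇v` is bounded near `(T, x_*)`, `bounds_near_top_of_not_isBackwardSingularPoint`, so the Hardy
dissipation is finite on a box, `hardyDissipation_lt_top_of_forall_fderiv_le`).
[cite: Seregin2014, Ch. 6 §6.1 Theorem 1.4, PDF p. 94] -/
theorem isBackwardSingularPoint_iff_hardyDissipation_eq_top {ν : ℝ} (hν : 0 < ν)
    {u₀ : EuclideanSpace ℝ (Fin 3) → EuclideanSpace ℝ (Fin 3)} {T : ℝ} (hT : 0 < T)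
    {u : ℝ → EuclideanSpace ℝ (Fin 3) → EuclideanSpace ℝ (Fin 3)} (hu : IsKatoSolutionOn T ν u₀ u)
    {v : ℝ → EuclideanSpace ℝ (Fin 3) → EuclideanSpace ℝ (Fin 3)}
    {p : ℝ → EuclideanSpace ℝ (Fin 3) → ℝ} (hcl : IsClassicalNSSolutionOn (Ioo 0 T) ν 0 v p)
    (hae : ∀ t ∈ Ioo 0 T, v t =ᵐ[volume] u t) (xs : EuclideanSpace ℝ (Fin 3)) :
    IsBackwardSingularPoint u ((T, xs) : ℝ × EuclideanSpace ℝ (Fin 3)) ↔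
      ∀ δ : ℝ, 0 < δ → ∀ ρ₀ : ℝ, 0 < ρ₀ →
        ∫⁻ z in Ioo (T - δ) T ×ˢ ball xs ρ₀,
          ENNReal.ofReal (frobeniusNormSq (fderiv ℝ (v z.1) z.2)) / ‖z.2 - xs‖ₑ = ∞ := by
  constructor
  · intro hsing δ hδ ρ₀ hρ₀
    exact hardyDissipation_eq_top_of_isBackwardSingularPoint hν hT hu hcl hae hsing hδ hρ₀
  · intro h
    by_contra hreg
    obtain ⟨r, hr, A, G, hAG⟩ := bounds_near_top_of_not_isBackwardSingularPoint hν hT hu hcl hae hreg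
    have hfin := hardyDissipation_lt_top_of_forall_fderiv_le (u := v) (a := T - r ^ 2) (b := T) hr
      (fun t ht x hx => (hAG t ht x hx).2) xs
    exact hfin.ne (h (r ^ 2) (by positivity) r hr)

/-! ### Two sink-wise estimates at a regular point (cut-off centred at the sink) -/

/-- **Hardy energy of a bounded field against the sink-centred cut-off.**  With the plateau
cut-off `φ` of the ledger centred at the sink `x₀` (scale `R/4`: `0 ≤ φ ≤ 1`, `φ = 0` off
`B(x₀, R/4)`), a field with `‖w‖ ≤ A` on `B(x₀, R/4)` has
`ofReal ∫ φ|w|²/|x − x₀| ≤ A² · (5/2)|B₁| (R/4)²` (`ofReal ∫ ≤ ∫⁻ ofReal`, the weight comparison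
`hardyEnergyBound_converse_ofReal_weighted_le`, and `hardyEnergyBound_necessity_hardy_le_of_norm_le`).
[folklore] -/
theorem hardyEnergyBound_regular_ofReal_hardy_le {A R : ℝ} {x₀ : EuclideanSpace ℝ (Fin 3)}
    (hρ : 0 < R / 4) {w : EuclideanSpace ℝ (Fin 3) → EuclideanSpace ℝ (Fin 3)}
    (hA : ∀ x ∈ ball x₀ (R / 4), ‖w x‖ ≤ A) :
    ENNReal.ofReal (∫ x, hardyEnergyBound_ledger_cutoff x₀ hρ x * ‖w x‖ ^ 2 / ‖x - x₀‖) ≤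
      ENNReal.ofReal (A ^ 2 * (5 / 2 *
        (volume : Measure (EuclideanSpace ℝ (Fin 3))).real (ball (0 : EuclideanSpace ℝ (Fin 3)) 1) *
          (R / 4) ^ 2)) := by
  have hφB : ∀ x ∉ ball x₀ (R / 4), hardyEnergyBound_ledger_cutoff x₀ hρ x = 0 := fun x hx => by
    by_contra h
    exact hx (hardyEnergyBound_ledger_mem_ball_of_cutoff_ne_zero x₀ hρ h)
  calc ENNReal.ofReal (∫ x, hardyEnergyBound_ledger_cutoff x₀ hρ x * ‖w x‖ ^ 2 / ‖x - x₀‖)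
      ≤ ∫⁻ x, ENNReal.ofReal (hardyEnergyBound_ledger_cutoff x₀ hρ x * ‖w x‖ ^ 2 / ‖x - x₀‖) :=
        ofReal_integral_le_lintegral_ofReal _
    _ ≤ ∫⁻ x, (ball x₀ (R / 4)).indicator (fun x => ENNReal.ofReal (‖w x‖ ^ 2) / ‖x - x₀‖ₑ) x :=
        lintegral_mono fun x => hardyEnergyBound_converse_ofReal_weighted_le
          (hardyEnergyBound_ledger_cutoff_le_one x₀ hρ) hφB (fun x => by positivity) x₀ x
    _ = ∫⁻ x in ball x₀ (R / 4), ENNReal.ofReal (‖w x‖ ^ 2) / ‖x - x₀‖ₑ :=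
        lintegral_indicator measurableSet_ball _
    _ = ∫⁻ x in ball x₀ (R / 4), ‖w x‖ₑ ^ 2 / ‖x - x₀‖ₑ := by
        refine lintegral_congr fun x => ?_
        rw [ENNReal.ofReal_pow (norm_nonneg _), ofReal_norm]
    _ ≤ _ := hardyEnergyBound_necessity_hardy_le_of_norm_le hρ hA x₀

/-- **Cut-off Hardy dissipation plus point sink over a window from pointwise bounds.**  With the
sink-centred cut-off `φ` (scale `R/4`), if `‖∇v(s)(x)‖ ≤ G` for `s ∈ (a, t)`, `x ∈ B(x₀, R/4)` and
`‖v(s, x₀)‖ ≤ A` for `s ∈ (a, t)`, `a ≤ t`, `ν ≥ 0`, then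
`ofReal(2ν ∫_a^t ∫ φ|∇v|²_F/|x − x₀| + 4πν ∫_a^t |v(s,x₀)|²)
  ≤ (2ν · 3G²(5/2)|B₁|(R/4)² + 4πν A²) · |(a, t)|`
(`|L|²_F ≤ 3‖L‖²`, the Newtonian potential of the ball, constants integrated over the window).
[folklore] -/
theorem hardyEnergyBound_regular_ofReal_dissipation_le {ν A G R a t : ℝ} (hν : 0 ≤ ν)
    {x₀ : EuclideanSpace ℝ (Fin 3)} (hρ : 0 < R / 4)
    {v : ℝ → EuclideanSpace ℝ (Fin 3) → EuclideanSpace ℝ (Fin 3)} (hat : a ≤ t)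
    (hG : ∀ s ∈ Ioo a t, ∀ x ∈ ball x₀ (R / 4), ‖fderiv ℝ (v s) x‖ ≤ G)
    (hA : ∀ s ∈ Ioo a t, ‖v s x₀‖ ≤ A) :
    ENNReal.ofReal (2 * ν * (∫ s in a..t, ∫ x, hardyEnergyBound_ledger_cutoff x₀ hρ x *
        frobeniusNormSq (fderiv ℝ (v s) x) / ‖x - x₀‖) +
      4 * Real.pi * ν * (∫ s in a..t, ‖v s x₀‖ ^ 2)) ≤
      (ENNReal.ofReal (2 * ν) * (ENNReal.ofReal (3 * G ^ 2) * ENNReal.ofReal (5 / 2 *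
          (volume : Measure (EuclideanSpace ℝ (Fin 3))).real (ball (0 : EuclideanSpace ℝ (Fin 3)) 1) *
            (R / 4) ^ 2)) +
        ENNReal.ofReal (4 * Real.pi * ν) * ENNReal.ofReal (A ^ 2)) * volume (Ioo a t) := by
  set φ := hardyEnergyBound_ledger_cutoff x₀ hρ with hφ
  set KX : ℝ≥0∞ := ENNReal.ofReal (3 * G ^ 2) * ENNReal.ofReal (5 / 2 *
    (volume : Measure (EuclideanSpace ℝ (Fin 3))).real (ball (0 : EuclideanSpace ℝ (Fin 3)) 1) *
      (R / 4) ^ 2) with hKX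
  have hφB : ∀ x ∉ ball x₀ (R / 4), φ x = 0 := fun x hx => by
    by_contra h
    exact hx (hardyEnergyBound_ledger_mem_ball_of_cutoff_ne_zero x₀ hρ h)
  set X : ℝ → ℝ := fun s => ∫ x, φ x * frobeniusNormSq (fderiv ℝ (v s) x) / ‖x - x₀‖ with hX
  set Y : ℝ → ℝ := fun s => ‖v s x₀‖ ^ 2 with hY
  -- slice bounds
  have hXs : ∀ s ∈ Ioo a t, ENNReal.ofReal (X s) ≤ KX := fun s hs => by
    calc ENNReal.ofReal (X s)
        ≤ ∫⁻ x, ENNReal.ofReal (φ x * frobeniusNormSq (fderiv ℝ (v s) x) / ‖x - x₀‖) :=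
          ofReal_integral_le_lintegral_ofReal _
      _ ≤ ∫⁻ x, (ball x₀ (R / 4)).indicator
            (fun x => ENNReal.ofReal (frobeniusNormSq (fderiv ℝ (v s) x)) / ‖x - x₀‖ₑ) x :=
          lintegral_mono fun x => hardyEnergyBound_converse_ofReal_weighted_le
            (hardyEnergyBound_ledger_cutoff_le_one x₀ hρ) hφB (fun x => frobeniusNormSq_nonneg _) x₀ x
      _ = ∫⁻ x in ball x₀ (R / 4), ENNReal.ofReal (frobeniusNormSq (fderiv ℝ (v s) x)) / ‖x - x₀‖ₑ :=
          lintegral_indicator measurableSet_ball _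
      _ ≤ ∫⁻ x in ball x₀ (R / 4), ENNReal.ofReal (3 * G ^ 2) * (‖x - x₀‖ₑ)⁻¹ := by
          refine setLIntegral_mono' measurableSet_ball fun x hx => ?_
          rw [div_eq_mul_inv]
          gcongr
          calc frobeniusNormSq (fderiv ℝ (v s) x) ≤ 3 * ‖fderiv ℝ (v s) x‖ ^ 2 :=
                frobeniusNormSq_le_three_mul_norm_sq _
            _ ≤ 3 * G ^ 2 := by
                have h := hG s hs x hx
                have h0 : 0 ≤ ‖fderiv ℝ (v s) x‖ := norm_nonneg _
                nlinarith
      _ = ENNReal.ofReal (3 * G ^ 2) * ∫⁻ x in ball x₀ (R / 4), (‖x - x₀‖ₑ)⁻¹ :=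
          lintegral_const_mul' _ _ ENNReal.ofReal_ne_top
      _ ≤ KX := by
          rw [hKX]
          gcongr
          exact hardyEnergyBound_necessity_lintegral_inv_enorm_le x₀ x₀ hρ
  have hYs : ∀ s ∈ Ioo a t, ENNReal.ofReal (Y s) ≤ ENNReal.ofReal (A ^ 2) := fun s hs =>
    ENNReal.ofReal_le_ofReal (pow_le_pow_left₀ (norm_nonneg _) (hA s hs) 2)
  have h2ν : (0 : ℝ) ≤ 2 * ν := by positivity
  have h4ν : (0 : ℝ) ≤ 4 * Real.pi * ν := by positivity
  change ENNReal.ofReal (2 * ν * (∫ s in a..t, X s) + 4 * Real.pi * ν * (∫ s in a..t, Y s)) ≤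
    (ENNReal.ofReal (2 * ν) * KX + ENNReal.ofReal (4 * Real.pi * ν) * ENNReal.ofReal (A ^ 2)) *
      volume (Ioo a t)
  rw [intervalIntegral.integral_of_le hat, intervalIntegral.integral_of_le hat,
    integral_Ioc_eq_integral_Ioo, integral_Ioc_eq_integral_Ioo]
  calc ENNReal.ofReal (2 * ν * (∫ s in Ioo a t, X s) + 4 * Real.pi * ν * (∫ s in Ioo a t, Y s))
      ≤ ENNReal.ofReal (2 * ν * ∫ s in Ioo a t, X s) +
        ENNReal.ofReal (4 * Real.pi * ν * ∫ s in Ioo a t, Y s) := ENNReal.ofReal_add_le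
    _ ≤ ENNReal.ofReal (2 * ν) * (∫⁻ s in Ioo a t, ENNReal.ofReal (X s)) +
        ENNReal.ofReal (4 * Real.pi * ν) * (∫⁻ s in Ioo a t, ENNReal.ofReal (Y s)) := by
        rw [ENNReal.ofReal_mul h2ν, ENNReal.ofReal_mul h4ν]
        exact add_le_add (mul_le_mul' le_rfl (ofReal_integral_le_lintegral_ofReal _))
          (mul_le_mul' le_rfl (ofReal_integral_le_lintegral_ofReal _))
    _ ≤ ENNReal.ofReal (2 * ν) * (∫⁻ _s in Ioo a t, KX) +
        ENNReal.ofReal (4 * Real.pi * ν) * (∫⁻ _s in Ioo a t, ENNReal.ofReal (A ^ 2)) :=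
        add_le_add (mul_le_mul' le_rfl (setLIntegral_mono' measurableSet_Ioo hXs))
          (mul_le_mul' le_rfl (setLIntegral_mono' measurableSet_Ioo hYs))
    _ = (ENNReal.ofReal (2 * ν) * KX + ENNReal.ofReal (4 * Real.pi * ν) * ENNReal.ofReal (A ^ 2)) *
        volume (Ioo a t) := by
        rw [setLIntegral_const, setLIntegral_const]
        ring

/-! ### Registered anchor (pure `∀` form, fully qualified) -/

/-- **Anchor `hardyEnergyBound_isBackwardSingularPoint_iff_hardyDissipation` (lead c7, `--supports
stmt-NavierStokesRegularity-7979`):** for `ν > 0`, `T > 0`, a Kato solution `u` on `[0, T)`, a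
classical representative `(v, p)` on `(0, T)` and any `x_*`, `(T, x_*)` is a backward singular
point of `u` iff `∫∫_{(T−δ,T)×B(x_*,ρ₀)} |∇v|²_F/|x − x_*| = ∞` for all `δ, ρ₀ > 0`
(`isBackwardSingularPoint_iff_hardyDissipation_eq_top`).
[cite: Seregin2014, Ch. 6 §6.1 Theorem 1.4, PDF p. 94] [cite: SereginSverak2009, §2 p. 8] -/
theorem hardyEnergyBound_isBackwardSingularPoint_iff_hardyDissipation :
    ∀ ν : ℝ, 0 < ν → ∀ (T : ℝ) (u₀ : EuclideanSpace ℝ (Fin 3) → EuclideanSpace ℝ (Fin 3))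
      (u : ℝ → EuclideanSpace ℝ (Fin 3) → EuclideanSpace ℝ (Fin 3)), 0 < T →
      Literature.Analysis.FluidPDE.IsKatoSolutionOn T ν u₀ u →
      ∀ (v : ℝ → EuclideanSpace ℝ (Fin 3) → EuclideanSpace ℝ (Fin 3))
        (p : ℝ → EuclideanSpace ℝ (Fin 3) → ℝ),
      Literature.Analysis.FluidPDE.IsClassicalNSSolutionOn (Set.Ioo 0 T) ν 0 v p →
      (∀ t ∈ Set.Ioo 0 T, v t =ᵐ[MeasureTheory.volume] u t) →
      ∀ xs : EuclideanSpace ℝ (Fin 3),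
        (Literature.Analysis.FluidPDE.IsBackwardSingularPoint u
            ((T, xs) : ℝ × EuclideanSpace ℝ (Fin 3)) ↔
          ∀ δ : ℝ, 0 < δ → ∀ ρ₀ : ℝ, 0 < ρ₀ →
            ∫⁻ z in Set.Ioo (T - δ) T ×ˢ Metric.ball xs ρ₀,
              ENNReal.ofReal (Literature.Analysis.FluidPDE.frobeniusNormSq (fderiv ℝ (v z.1) z.2))
                / ‖z.2 - xs‖ₑ = ⊤) :=
  fun _ν hν _T _u₀ _u hT hu _v _p hcl hae xs =>
    isBackwardSingularPoint_iff_hardyDissipation_eq_top hν hT hu hcl hae xs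

end Summit.NavierStokesRegularity.NavierStokesRegularity.Theorems

end
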